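import Summits.BirchSwinnertonDyer.Rank1Residual.Additive.CensusX42ForallAnomalous
import HarnessLib

/-!
# Rescaling the `p`-adic height datum, IV: the `∀ Dh` packaging of the "up to a `p`-adic unit" inputs
# is VACUOUS on ANOMALOUS unit rows — kernel witnesses and the affected theorems (cell `b2b-bsdres`,
# census cell `bsd-formula-census`, seat `b2b-bsdres-census-ctyper1` gen 9; prequel `CensusX42ForallAnomalous`)

HONEST FRAMING (cell `b2b-bsdres`, run/shared/lean/b2b/bsd-rank1-residual/, verbatim in every
file): the goal of the cell is to DELETE the COMBINATION-SHAPED residual classes of the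
Birch–Swinnerton-Dyer formula for ALL analytic-rank `≤ 1` elliptic curves over `ℚ` — "full BSD
formula for every rank `≤ 1` curve in class `C`" assembled STRICTLY from published theorems — so
that the rank-`≤ 1` remainder becomes exactly the CONSTRUCTION-SHAPED classes, which are TYPED
(missing-input `Prop`s), NOT attempted. This is not "finishing BSD". Census cell
(bsd-formula-census): research instrumentation; census output = EVIDENCE / conjecture items, never a
Literature fact; labels / RESIDUAL-MAP marks UNCHANGED (O7-ord OPEN; X3♯ / X4♯ CONSTRUCTION-SHAPED);
nothing booked. Theorems only (no definition, no named fact); named facts enter as HYPOTHESES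
(`hDel3`, `hK` / `hWu`, `hGZ`, `hGZK`, `hmod`, `hmodD`).

## What

§4 class forms of the prequel's §2–§3: on (G-ord, `e = 2`) rows with Kato's half (X4♯ ∩ {`ρ̄` onto})
or Wuthrich's Thm. 16 half (X3♯), EVERY odd `p`, analytic rank `1`, ANOMALOUS
(`¬ ReductionNonAnomalous W p`) and UNIT (`ord_p #Ш_an = 0`): a (B)-datum `Dh` with the Schneider
rider and the typed branch `p`-adic Gross–Zagier of the parity of `(p−1)/2` has `p⁻¹ · Dh` AGAIN a
(B)-datum. §5 the two "up to a unit" identities for `Dh` and `p⁻¹·Dh` at one twist datum are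
incompatible (`u = u'·p⁻¹` in `ℤ_p^×` is absurd). §6 WITNESSES on such a row, given ONE (B)-datum:
`¬ ∀ Dh, LeadingTermClauses W p Dh → SchneiderConjecture Dh ∧ BranchPAdicGrossZagier[Odd]At W p Dh`
(n1011's `hGZ` packaging; X4Gord even / odd, X3Gord odd) and
`¬ ∀ Dh, LeadingTermClauses W p Dh → CensusX42.ValRelationAt W p Dh` (this seat's window-grade
packaging; X4Gord, X3Gord). Sequel `CensusX42ForallAnomalousThree.lean`: the `p = 3` forms with
EXACTLY the binder lists of n1011-p16's two `∀ Dh` unit-row wrappers.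

## ERRATUM-GRADE READING (which theorems this touches; statements of record)

A theorem whose hypotheses contain the packaging `∀ Dh, LeadingTermClauses W p Dh → X Dh` with `X`
pinning `‖Reg_p(E,Dh)‖` (`BranchPAdicGrossZagier[Odd|Mult]At`, `ValRelationAt`, `RelationAt`) is, ON THE
ANOMALOUS UNIT ROWS of its locus, TRUE VACUOUSLY whenever its other hypotheses yield a (B)-datum —
NOT coverage there. Scan of the cell's tree (2026-08-21, 150 theorems carrying the packaging): every
`BSDp`-concluding one EITHER carries `hna : ReductionNonAnomalous W p` (IMC-version nodes, iffs,
capstones — consistent: off the anomalous rows the (B)-data are one unit class in norm) OR lives on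
(M) (`ReductionNonAnomalous` automatic) OR is in gen 8's exact-grade ERRATUM list
(`CensusX42ForallErratum.lean`) — EXCEPT n1011-p16's `p = 3` unit-row wrappers
`ClassX4Gord.bsdp_three_rankOne_of_katoHalf_of_delbourgo_of_forall_branchPAdicGrossZagierOdd_of_shaAn_unit`,
`ClassX3Gord.bsdp_three_rankOne_of_wuthrichHalf_of_delbourgo_of_forall_branchPAdicGrossZagierOdd_of_shaAn_unit`
(`RankOneUpperHalfUnitRows.lean`) and the (S10i) isogeny form
`ClassX3Gord.bsdp_three_rankOne_of_isIsogenous_of_wuthrichHalf_of_delbourgo_of_forall_branchPAdicGrossZagierOdd_of_shaAn_unit`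
(`RankOneUpperHalfUnitRowsIsogeny.lean`; packaging at the isogenous `E₀`), which are therefore VACUOUS
ON THE ANOMALOUS ROWS AT 3 (`3 ∣ #Ẽ♭(𝔽₃)` for `E`, resp. `E₀`; r3's (S10) matrix `cells/n1011/ROUTE-3.md`
l.76: the anomalous Gord3 / X3 unit rows) and stand on the non-anomalous ones (sequel §7). STATEMENTS
OF RECORD on anomalous rows: the
POINTWISE forms (one `Dh` carrying `hB`, `hS`, `hGZ` / `hrel`) —
`ClassX4Gord/ClassX3Gord.bsdp_three_rankOne_of_{katoHalf,wuthrichHalf}_of_branchPAdicGrossZagierOdd_of_shaAn_unit`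
(same file), this seat's `CensusX42ValUnitRows` / `CensusX42UnitRows` §1 pointwise nodes. The three
converters `CensusX42ValBridges.forall_schneider_and_branchPAdicGrossZagier[∅|Odd|Mult]At_of_forall_valRelationAt`
map one vacuous hypothesis to another on those rows (harmless, useless there). RULE for consumers
(extends gen 8 §3): an `hGZ`/`hrel`-shaped `∀ Dh` hypothesis is admissible only together with
`ReductionNonAnomalous W p` (or on (M)); on anomalous rows use the pointwise binders.

References: [Delbourgo2002] J. Number Theory 95 (2002) p. 39 (`ℓ_p(E)`), Thm. (B) (p. 40);
[Kato2004Asterisque] Thm. 17.4 (3); [Wuthrich2014] Thm. 16, Lemma 20; [MazurTateTeitelbaum1986Invent]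
§I.13–I.14, §II.4; [GrossZagier1986] Thm. I.(7.3); [Delbourgo1998] §2.5; [Miller2011LMS] Def. 1.1.
-/

set_option autoImplicit false

noncomputable section

open scoped Classical MatrixGroups ModularForm NumberField

open CongruenceSubgroup WeierstrassCurve NumberField Literature.NumberTheory.EllipticCurves
  Literature.NumberTheory.EllipticCurves.ModularForms
  Literature.NumberTheory.EllipticCurves.Rank1Residual
  Literature.NumberTheory.EllipticCurves.Rank1Residual.Typed
  Literature.NumberTheory.EllipticCurves.Delbourgo2002
  Literature.NumberTheory.GaloisRepresentations
  Literature.Barriers.BirchSwinnertonDyer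
  IsDedekindDomain

namespace Summit.BirchSwinnertonDyer.Rank1Residual.Additive

/-! ### §4 Class forms: on an anomalous unit row of a Kato / Wuthrich class, `p⁻¹ · Dh` is a (B)-datum -/

open CensusX42

variable {W : WeierstrassCurve ℚ} [W.IsElliptic] [W.IsGloballyMinimal] {p : ℕ} [hp : Fact p.Prime]

/-- **X4♯(G-ord) ∩ `I₀*` ∩ {`ρ̄_{E,p}` onto}, EVERY odd `p` (`p = 3` included), `r_an = 1`, ANOMALOUS
(`¬ ReductionNonAnomalous W p`), UNIT row (`ord_p #Ш_an = 0`):** a (B)-datum `Dh` with the rider and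
the typed branch `p`-adic Gross–Zagier of the parity of `(p−1)/2` has `p⁻¹ · Dh` AGAIN a (B)-datum.
Kato's brick `ι g = C(u·ϖ)·B_{(p−1)/2}` is available at EVERY cyclotomic tuple
(`isTorsion_and_exists_iota_eq_branch_of_katoComponent`, tower from surj(p) by Wuthrich's Lemma 20),
so §2 gives `ℓ = 1` at every tuple and §3 applies. [cite: Kato2004Asterisque, Thm. 17.4 (3) (p. 273)]
[cite: Wuthrich2014, Lemma 20 (p. 399)] [cite: Delbourgo2002, Theorem (B) (p. 40) and p. 39 (ℓ_p(E))] -/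
theorem ClassX4Gord.leadingTermClauses_inv_prime_of_katoHalf_of_branchPAdicGrossZagier_of_shaAn_unit_of_anomalous
    (hK : Wuthrich2014.kato_halfEigenCharIdeal_dvd_cyclotomicPrime_of_surjective)
    (hGZK : rank_eq_analyticRank_of_analyticRank_le_one) (hmod : hasEntireLFunction_rat)
    (hmodD : nonempty_modularParametrizationData) (hX : ClassX4Gord W p)
    (he : semistabilityIndex W p = 2) (hsurj : Surj W p) (hr : W.analyticRank = 1)
    (hanom : ¬ ReductionNonAnomalous W p)
    {Dh Dh' : PAdicHeightData W p} (hB : LeadingTermClauses W p Dh) (hS : SchneiderConjecture Dh)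
    (hE : p % 4 = 1 → BranchPAdicGrossZagierAt W p Dh)
    (hO : p % 4 = 3 → BranchPAdicGrossZagierOddAt W p Dh)
    (hc : ∀ P Q, Dh'.pairing P Q = (p : ℚ_[p])⁻¹ * Dh.pairing P Q)
    {s : ℚ} (hs : shaAn W = (s : ℂ)) (hv : padicValRat p s = 0) :
    LeadingTermClauses W p Dh' := by
  have hp2 : p ≠ 2 := hX.addv.1
  have hr1 : W.mordellWeilRank = 1 := by rw [(hGZK W hr.le).1, hr]
  obtain ⟨V, iV, iVm, C, hV, hC⟩ := hX.exists_goodOrd_pStar_twist_model W p he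
  haveI : NeZero (V.conductorNorm ℤ) := ⟨(V.conductorNorm_pos_holds).ne'⟩
  obtain ⟨Dm⟩ := hmodD V
  obtain ⟨ϖ, hϖ⟩ := exists_periodRatio_parity (p := p) V Dm
  have hj := padicValRat_j_nonneg_of_typeGOrd W p hX.typeGOrd
  have hsV : Surj V p := (surj_iff_of_model_twist V p (pStar_ne_zero p) ⟨C, hC⟩).mp hsurj
  have hsurjV : ∀ n : ℕ, V.HasSurjectiveModNGaloisRep (p ^ n : ℕ) :=
    V.forall_hasSurjectiveModNGaloisRep_pow_of_goodOrdinary_of_surj p hp2 hV.1 hV.2 hsV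
  have hodd4 : p % 4 = 1 ∨ p % 4 = 3 := by obtain ⟨k, hk⟩ := hp.out.odd_of_ne_two hp2; omega
  refine leadingTermClauses_of_pairing_eq_inv_prime_mul_of_anomalous hanom hr1 hB hc ?_
  intro κ γ hκ hγ hγ' D _ hXt fE hchar _ _
  obtain ⟨-, g, hg, u, hι⟩ := isTorsion_and_exists_iota_eq_branch_of_katoComponent W p
    (Kato2004.charIdeal_dvd_padicLFunctionBranch_component_of_surjective_of_half hK) hj hp2 V
    ⟨C, hC⟩ (Or.inl hV) hsurjV hκ hγ hγ' Dm.isNewformOf D ϖ hϖ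
  rcases hodd4 with h1 | h3
  · have hev : Even (p / 2) := ⟨p / 4, by omega⟩
    have hC' : C • V.quadraticTwist (p : ℚ) = W := by
      rw [pStar_eq_of_mod_four p (Or.inl h1), if_pos h1] at hC; exact hC
    rw [if_pos hev] at hϖ hι
    obtain ⟨u', q, hlead, hpgz⟩ := hE h1 V h1 ⟨C, hC'⟩ hV Dm.isNewformOf ϖ hϖ
    exact (exists_identity_dvd_prime_of_iota_eq_of_pgz_of_shaAn_unit hp2 hGZK hmod hr hB hS hκ hγ
      hγ' D hXt hchar hg hι hlead hpgz hs hv).2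
  · have hnev : ¬ Even (p / 2) := by rw [Nat.not_even_iff_odd]; exact ⟨p / 4, by omega⟩
    have hC' : C • V.quadraticTwist (-(p : ℚ)) = W := by
      rw [pStar_eq_of_mod_four p (Or.inr h3), if_neg (by omega)] at hC; exact hC
    rw [if_neg hnev] at hϖ hι
    obtain ⟨u', q, hlead, hpgz⟩ := hO h3 V h3 ⟨C, hC'⟩ hV Dm.isNewformOf ϖ hϖ
    exact (exists_identity_dvd_prime_of_iota_eq_of_pgz_of_shaAn_unit hp2 hGZK hmod hr hB hS hκ hγ
      hγ' D hXt hchar hg hι hlead hpgz hs hv).2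

/-- **X3♯(G-ord) ∩ `I₀*` (reducible `E[p]`, NO image hypothesis), EVERY odd `p`, `r_an = 1`,
ANOMALOUS, UNIT row:** the same from Wuthrich's Thm. 16 half (brick
`isTorsion_and_exists_iota_eq_branch_of_wuthrichComponent`). [cite: Wuthrich2014, Thm. 16 (p. 397)]
[cite: Delbourgo2002, Theorem (B) (p. 40) and p. 39 (ℓ_p(E))] -/
theorem ClassX3Gord.leadingTermClauses_inv_prime_of_wuthrichHalf_of_branchPAdicGrossZagier_of_shaAn_unit_of_anomalous
    (hWu : Wuthrich2014.thm16_halfEigenCharIdeal_dvd_cyclotomicPrime)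
    (hGZK : rank_eq_analyticRank_of_analyticRank_le_one) (hmod : hasEntireLFunction_rat)
    (hmodD : nonempty_modularParametrizationData) (hX : ClassX3Gord W p) (hp2 : p ≠ 2)
    (he : semistabilityIndex W p = 2) (hr : W.analyticRank = 1)
    (hanom : ¬ ReductionNonAnomalous W p)
    {Dh Dh' : PAdicHeightData W p} (hB : LeadingTermClauses W p Dh) (hS : SchneiderConjecture Dh)
    (hE : p % 4 = 1 → BranchPAdicGrossZagierAt W p Dh)
    (hO : p % 4 = 3 → BranchPAdicGrossZagierOddAt W p Dh)
    (hc : ∀ P Q, Dh'.pairing P Q = (p : ℚ_[p])⁻¹ * Dh.pairing P Q)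
    {s : ℚ} (hs : shaAn W = (s : ℂ)) (hv : padicValRat p s = 0) :
    LeadingTermClauses W p Dh' := by
  have hr1 : W.mordellWeilRank = 1 := by rw [(hGZK W hr.le).1, hr]
  obtain ⟨V, iV, iVm, C, hV, hC⟩ := hX.exists_goodOrd_pStar_twist_model W p hp2 he
  haveI : NeZero (V.conductorNorm ℤ) := ⟨(V.conductorNorm_pos_holds).ne'⟩
  obtain ⟨Dm⟩ := hmodD V
  obtain ⟨ϖ, hϖ⟩ := exists_periodRatio_parity (p := p) V Dm
  have hj := padicValRat_j_nonneg_of_typeGOrd W p hX.typeGOrd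
  have hodd4 : p % 4 = 1 ∨ p % 4 = 3 := by obtain ⟨k, hk⟩ := hp.out.odd_of_ne_two hp2; omega
  refine leadingTermClauses_of_pairing_eq_inv_prime_mul_of_anomalous hanom hr1 hB hc ?_
  intro κ γ hκ hγ hγ' D _ hXt fE hchar _ _
  obtain ⟨-, g, hg, u, hι⟩ := isTorsion_and_exists_iota_eq_branch_of_wuthrichComponent W p
    (Wuthrich2014.charIdeal_dvd_padicLFunctionBranch_component_of_half hWu) hj hp2 V
    ⟨C, hC⟩ (Or.inl hV) hX.classX3.1 hκ hγ hγ' Dm.isNewformOf D ϖ hϖ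
  rcases hodd4 with h1 | h3
  · have hev : Even (p / 2) := ⟨p / 4, by omega⟩
    have hC' : C • V.quadraticTwist (p : ℚ) = W := by
      rw [pStar_eq_of_mod_four p (Or.inl h1), if_pos h1] at hC; exact hC
    rw [if_pos hev] at hϖ hι
    obtain ⟨u', q, hlead, hpgz⟩ := hE h1 V h1 ⟨C, hC'⟩ hV Dm.isNewformOf ϖ hϖ
    exact (exists_identity_dvd_prime_of_iota_eq_of_pgz_of_shaAn_unit hp2 hGZK hmod hr hB hS hκ hγ
      hγ' D hXt hchar hg hι hlead hpgz hs hv).2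
  · have hnev : ¬ Even (p / 2) := by rw [Nat.not_even_iff_odd]; exact ⟨p / 4, by omega⟩
    have hC' : C • V.quadraticTwist (-(p : ℚ)) = W := by
      rw [pStar_eq_of_mod_four p (Or.inr h3), if_neg (by omega)] at hC; exact hC
    rw [if_neg hnev] at hϖ hι
    obtain ⟨u', q, hlead, hpgz⟩ := hO h3 V h3 ⟨C, hC'⟩ hV Dm.isNewformOf ϖ hϖ
    exact (exists_identity_dvd_prime_of_iota_eq_of_pgz_of_shaAn_unit hp2 hGZK hmod hr hB hS hκ hγ
      hγ' D hXt hchar hg hι hlead hpgz hs hv).2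

/-! ### §5 The two identities for `Dh` and `p⁻¹ · Dh` at one twist datum are incompatible -/

namespace CensusX42

omit [W.IsGloballyMinimal] in
/-- Two "up to a unit" identities `x = u·q·Reg_p(E,Dh) = u'·q'·Reg_p(E,Dh')` with
`⟨,⟩_{Dh'} = p⁻¹·⟨,⟩_{Dh}`, rank one, `Reg_p(E,Dh) ≠ 0` and `q = q'` forced by
`L'(E,1) = q·Ω_E·Reg_∞ = q'·Ω_E·Reg_∞ ≠ 0`, are incompatible: `u = u'·p⁻¹` has norm `p ≠ 1`. [folklore] -/
theorem false_of_unit_identity_of_unit_identity_inv_prime (hmod : hasEntireLFunction_rat)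
    (hr1 : W.mordellWeilRank = 1) {Dh Dh' : PAdicHeightData W p} (hS : SchneiderConjecture Dh)
    (hc : ∀ P Q, Dh'.pairing P Q = (p : ℚ_[p])⁻¹ * Dh.pairing P Q)
    {x : ℚ_[p]} {u u' : ℤ_[p]ˣ} {q q' : ℚ}
    (hlead : W.leadingLCoeff = (q : ℂ) * (W.realPeriodRat : ℂ) * (W.regulator : ℂ))
    (hlead' : W.leadingLCoeff = (q' : ℂ) * (W.realPeriodRat : ℂ) * (W.regulator : ℂ))
    (h : x = ((u : ℤ_[p]) : ℚ_[p]) * (q : ℚ_[p]) * padicRegulator Dh)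
    (h' : x = ((u' : ℤ_[p]) : ℚ_[p]) * (q' : ℚ_[p]) * padicRegulator Dh') : False := by
  have hΩ : (W.realPeriodRat : ℂ) ≠ 0 := by exact_mod_cast W.realPeriodRat_pos_holds.ne'
  have hReg : (W.regulator : ℂ) ≠ 0 := by exact_mod_cast (regulator_pos_holds W).ne'
  have hqq : q' = q := by
    have h1 : (q' : ℂ) * ((W.realPeriodRat : ℂ) * (W.regulator : ℂ)) =
        (q : ℂ) * ((W.realPeriodRat : ℂ) * (W.regulator : ℂ)) := by
      rw [← mul_assoc, ← mul_assoc, ← hlead', ← hlead]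
    exact_mod_cast mul_right_cancel₀ (mul_ne_zero hΩ hReg) h1
  have hL0 : W.leadingLCoeff ≠ 0 := W.leadingLCoeff_ne_zero_holds (hmod W)
  have hq0 : q ≠ 0 := by
    rintro rfl
    apply hL0
    rw [hlead]
    simp
  have hqQ : ((q : ℚ) : ℚ_[p]) ≠ 0 := by exact_mod_cast hq0
  have hpQ : (p : ℚ_[p]) ≠ 0 := by exact_mod_cast hp.out.ne_zero
  have hR : padicRegulator Dh ≠ 0 := hS
  rw [hqq, padicRegulator_eq_of_pairing_eq_mul hc, hr1, pow_one] at h'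
  have huu : ((u : ℤ_[p]) : ℚ_[p]) = ((u' : ℤ_[p]) : ℚ_[p]) * (p : ℚ_[p])⁻¹ := by
    have h2 : ((u : ℤ_[p]) : ℚ_[p]) * ((q : ℚ_[p]) * padicRegulator Dh) =
        ((u' : ℤ_[p]) : ℚ_[p]) * (p : ℚ_[p])⁻¹ * ((q : ℚ_[p]) * padicRegulator Dh) := by
      rw [← mul_assoc, ← h, h']; ring
    exact mul_right_cancel₀ (mul_ne_zero hqQ hR) h2
  have hn := congrArg (‖·‖) huu
  simp only [norm_mul, norm_inv, norm_padicIntUnits_coe, Padic.norm_p, inv_inv, one_mul] at hn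
  have hp1 : (1 : ℝ) < p := by exact_mod_cast hp.out.one_lt
  linarith

end CensusX42

/-! ### §6 WITNESSES: the `∀ Dh` packaging is unsatisfiable on anomalous unit rows -/

/-- **X4♯(G-ord) ∩ `I₀*` ∩ {`ρ̄` onto}, ODD branch (`p ≡ 3 (mod 4)`, `p = 3` included), `r_an = 1`,
ANOMALOUS, UNIT row, one (B)-datum in hand: n1011's packaging
`∀ Dh, LeadingTermClauses → Schneider ∧ BranchPAdicGrossZagierOddAt` is FALSE** (`Dh` and `p⁻¹·Dh` are
both (B)-data, §4; their identities at one twist datum clash, §5). Any theorem carrying this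
hypothesis on such a row is vacuous there. [cite: Delbourgo2002, Theorem (B) (p. 40) and p. 39 (ℓ_p(E))]
[cite: Kato2004Asterisque, Thm. 17.4 (3) (p. 273)] [cite: Wuthrich2014, Lemma 20 (p. 399)] -/
theorem ClassX4Gord.not_forall_leadingTermClauses_imp_branchPAdicGrossZagierOdd_of_shaAn_unit_of_anomalous
    (hK : Wuthrich2014.kato_halfEigenCharIdeal_dvd_cyclotomicPrime_of_surjective)
    (hGZK : rank_eq_analyticRank_of_analyticRank_le_one) (hmod : hasEntireLFunction_rat)
    (hmodD : nonempty_modularParametrizationData) (hX : ClassX4Gord W p)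
    (he : semistabilityIndex W p = 2) (hp4 : p % 4 = 3) (hsurj : Surj W p) (hr : W.analyticRank = 1)
    (hanom : ¬ ReductionNonAnomalous W p) (hDh : ∃ Dh : PAdicHeightData W p, LeadingTermClauses W p Dh)
    {s : ℚ} (hs : shaAn W = (s : ℂ)) (hv : padicValRat p s = 0) :
    ¬ ∀ Dh : PAdicHeightData W p, LeadingTermClauses W p Dh →
        SchneiderConjecture Dh ∧ BranchPAdicGrossZagierOddAt W p Dh := by
  intro hall
  have hr1 : W.mordellWeilRank = 1 := by rw [(hGZK W hr.le).1, hr]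
  obtain ⟨Dh, hB⟩ := hDh
  obtain ⟨hS, hGZ⟩ := hall Dh hB
  obtain ⟨Dh', hc⟩ := CensusX42.exists_pairing_eq_mul ((p : ℚ_[p])⁻¹) Dh
  have hB' := hX.leadingTermClauses_inv_prime_of_katoHalf_of_branchPAdicGrossZagier_of_shaAn_unit_of_anomalous
    hK hGZK hmod hmodD he hsurj hr hanom hB hS (fun h1 ↦ absurd h1 (by omega)) (fun _ ↦ hGZ) hc hs hv
  obtain ⟨-, hGZ'⟩ := hall Dh' hB'
  obtain ⟨V, iV, iVm, C, hV, hC⟩ := hX.exists_goodOrd_pStar_twist_model W p he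
  haveI : NeZero (V.conductorNorm ℤ) := ⟨(V.conductorNorm_pos_holds).ne'⟩
  obtain ⟨Dm⟩ := hmodD V
  obtain ⟨ϖ, -, hϖ⟩ := exists_rat_mul_imaginaryPeriodRat_eq_minusPeriod Dm
  have hC' : C • V.quadraticTwist (-(p : ℚ)) = W := by
    rw [pStar_eq_of_mod_four p (Or.inr hp4), if_neg (by omega)] at hC; exact hC
  obtain ⟨u, q, hlead, hpgz⟩ := hGZ V hp4 ⟨C, hC'⟩ hV Dm.isNewformOf ϖ hϖ
  obtain ⟨u', q', hlead', hpgz'⟩ := hGZ' V hp4 ⟨C, hC'⟩ hV Dm.isNewformOf ϖ hϖ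
  exact CensusX42.false_of_unit_identity_of_unit_identity_inv_prime hmod hr1 hS hc hlead hlead'
    hpgz hpgz'

/-- **X4♯(G-ord) ∩ `I₀*` ∩ {`ρ̄` onto}, EVEN branch (`p ≡ 1 (mod 4)`), `r_an = 1`, ANOMALOUS, UNIT
row: `∀ Dh, LeadingTermClauses → Schneider ∧ BranchPAdicGrossZagierAt` is FALSE.**
[cite: Delbourgo2002, Theorem (B) (p. 40) and p. 39 (ℓ_p(E))] [cite: Kato2004Asterisque, Thm. 17.4 (3) (p. 273)] -/
theorem ClassX4Gord.not_forall_leadingTermClauses_imp_branchPAdicGrossZagier_of_shaAn_unit_of_anomalous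
    (hK : Wuthrich2014.kato_halfEigenCharIdeal_dvd_cyclotomicPrime_of_surjective)
    (hGZK : rank_eq_analyticRank_of_analyticRank_le_one) (hmod : hasEntireLFunction_rat)
    (hmodD : nonempty_modularParametrizationData) (hX : ClassX4Gord W p)
    (he : semistabilityIndex W p = 2) (hp4 : p % 4 = 1) (hsurj : Surj W p) (hr : W.analyticRank = 1)
    (hanom : ¬ ReductionNonAnomalous W p) (hDh : ∃ Dh : PAdicHeightData W p, LeadingTermClauses W p Dh)
    {s : ℚ} (hs : shaAn W = (s : ℂ)) (hv : padicValRat p s = 0) :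
    ¬ ∀ Dh : PAdicHeightData W p, LeadingTermClauses W p Dh →
        SchneiderConjecture Dh ∧ BranchPAdicGrossZagierAt W p Dh := by
  intro hall
  have hr1 : W.mordellWeilRank = 1 := by rw [(hGZK W hr.le).1, hr]
  obtain ⟨Dh, hB⟩ := hDh
  obtain ⟨hS, hGZ⟩ := hall Dh hB
  obtain ⟨Dh', hc⟩ := CensusX42.exists_pairing_eq_mul ((p : ℚ_[p])⁻¹) Dh
  have hB' := hX.leadingTermClauses_inv_prime_of_katoHalf_of_branchPAdicGrossZagier_of_shaAn_unit_of_anomalous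
    hK hGZK hmod hmodD he hsurj hr hanom hB hS (fun _ ↦ hGZ) (fun h3 ↦ absurd h3 (by omega)) hc hs hv
  obtain ⟨-, hGZ'⟩ := hall Dh' hB'
  obtain ⟨V, iV, iVm, C, hV, hC⟩ := hX.exists_goodOrd_pStar_twist_model W p he
  haveI : NeZero (V.conductorNorm ℤ) := ⟨(V.conductorNorm_pos_holds).ne'⟩
  obtain ⟨Dm⟩ := hmodD V
  obtain ⟨ϖ, -, hϖ, -⟩ := Dm.exists_rat_mul_realPeriodRat_eq_plusPeriod
  have hC' : C • V.quadraticTwist (p : ℚ) = W := by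
    rw [pStar_eq_of_mod_four p (Or.inl hp4), if_pos hp4] at hC; exact hC
  obtain ⟨u, q, hlead, hpgz⟩ := hGZ V hp4 ⟨C, hC'⟩ hV Dm.isNewformOf ϖ hϖ
  obtain ⟨u', q', hlead', hpgz'⟩ := hGZ' V hp4 ⟨C, hC'⟩ hV Dm.isNewformOf ϖ hϖ
  exact CensusX42.false_of_unit_identity_of_unit_identity_inv_prime hmod hr1 hS hc hlead hlead'
    hpgz hpgz'

/-- **X3♯(G-ord) ∩ `I₀*` (reducible `E[p]`), ODD branch, EVERY `p ≡ 3 (mod 4)` (`p = 3` included),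
`r_an = 1`, ANOMALOUS, UNIT row: `∀ Dh, LeadingTermClauses → Schneider ∧ BranchPAdicGrossZagierOddAt` is
FALSE** (Wuthrich's Thm. 16 half). [cite: Wuthrich2014, Thm. 16 (p. 397)]
[cite: Delbourgo2002, Theorem (B) (p. 40) and p. 39 (ℓ_p(E))] -/
theorem ClassX3Gord.not_forall_leadingTermClauses_imp_branchPAdicGrossZagierOdd_of_shaAn_unit_of_anomalous
    (hWu : Wuthrich2014.thm16_halfEigenCharIdeal_dvd_cyclotomicPrime)
    (hGZK : rank_eq_analyticRank_of_analyticRank_le_one) (hmod : hasEntireLFunction_rat)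
    (hmodD : nonempty_modularParametrizationData) (hX : ClassX3Gord W p)
    (he : semistabilityIndex W p = 2) (hp4 : p % 4 = 3) (hr : W.analyticRank = 1)
    (hanom : ¬ ReductionNonAnomalous W p) (hDh : ∃ Dh : PAdicHeightData W p, LeadingTermClauses W p Dh)
    {s : ℚ} (hs : shaAn W = (s : ℂ)) (hv : padicValRat p s = 0) :
    ¬ ∀ Dh : PAdicHeightData W p, LeadingTermClauses W p Dh →
        SchneiderConjecture Dh ∧ BranchPAdicGrossZagierOddAt W p Dh := by
  intro hall
  have hp2 : p ≠ 2 := by omega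
  have hr1 : W.mordellWeilRank = 1 := by rw [(hGZK W hr.le).1, hr]
  obtain ⟨Dh, hB⟩ := hDh
  obtain ⟨hS, hGZ⟩ := hall Dh hB
  obtain ⟨Dh', hc⟩ := CensusX42.exists_pairing_eq_mul ((p : ℚ_[p])⁻¹) Dh
  have hB' := hX.leadingTermClauses_inv_prime_of_wuthrichHalf_of_branchPAdicGrossZagier_of_shaAn_unit_of_anomalous
    hWu hGZK hmod hmodD hp2 he hr hanom hB hS (fun h1 ↦ absurd h1 (by omega)) (fun _ ↦ hGZ) hc hs hv
  obtain ⟨-, hGZ'⟩ := hall Dh' hB'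
  obtain ⟨V, iV, iVm, C, hV, hC⟩ := hX.exists_goodOrd_pStar_twist_model W p hp2 he
  haveI : NeZero (V.conductorNorm ℤ) := ⟨(V.conductorNorm_pos_holds).ne'⟩
  obtain ⟨Dm⟩ := hmodD V
  obtain ⟨ϖ, -, hϖ⟩ := exists_rat_mul_imaginaryPeriodRat_eq_minusPeriod Dm
  have hC' : C • V.quadraticTwist (-(p : ℚ)) = W := by
    rw [pStar_eq_of_mod_four p (Or.inr hp4), if_neg (by omega)] at hC; exact hC
  obtain ⟨u, q, hlead, hpgz⟩ := hGZ V hp4 ⟨C, hC'⟩ hV Dm.isNewformOf ϖ hϖ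
  obtain ⟨u', q', hlead', hpgz'⟩ := hGZ' V hp4 ⟨C, hC'⟩ hV Dm.isNewformOf ϖ hϖ
  exact CensusX42.false_of_unit_identity_of_unit_identity_inv_prime hmod hr1 hS hc hlead hlead'
    hpgz hpgz'

/-- **(G-ord, `e = 2`) ∩ {`ρ̄` onto}, EVERY odd `p`, `r_an = 1`, ANOMALOUS, UNIT row: this seat's
window-grade packaging `∀ Dh, LeadingTermClauses → CensusX42.ValRelationAt W p Dh` is FALSE** — the
window relation pins `‖Reg_p(E,Dh)‖` (`norm_padicRegulator_eq_of_valRelationAt_of_valRelationAt`), while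
`Dh` and `p⁻¹·Dh` are both (B)-data. (GZ I.(7.3) enters through the `ValRelationAt ⇒ Schneider ∧
branch p-adic GZ` bridges.) [cite: Delbourgo1998, §2.5 BS-D(p) (ii) (pp. 151–152) (shape only)]
[cite: Delbourgo2002, Theorem (B) (p. 40) and p. 39 (ℓ_p(E))] [cite: GrossZagier1986, Thm. I.(7.3)] -/
theorem ClassX4Gord.not_forall_leadingTermClauses_imp_censusX42Val_of_shaAn_unit_of_anomalous
    (hK : Wuthrich2014.kato_halfEigenCharIdeal_dvd_cyclotomicPrime_of_surjective)
    (hGZ : GrossZagier1986_thm_I_7_3) (hGZK : rank_eq_analyticRank_of_analyticRank_le_one)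
    (hmod : hasEntireLFunction_rat) (hmodD : nonempty_modularParametrizationData) (hX : ClassX4Gord W p)
    (he : semistabilityIndex W p = 2) (hsurj : Surj W p) (hr : W.analyticRank = 1)
    (hanom : ¬ ReductionNonAnomalous W p) (hDh : ∃ Dh : PAdicHeightData W p, LeadingTermClauses W p Dh)
    {s : ℚ} (hs : shaAn W = (s : ℂ)) (hv : padicValRat p s = 0) :
    ¬ ∀ Dh : PAdicHeightData W p, LeadingTermClauses W p Dh → CensusX42.ValRelationAt W p Dh := by
  intro hall
  have hp2 : p ≠ 2 := hX.addv.1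
  have hr1 : W.mordellWeilRank = 1 := by rw [(hGZK W hr.le).1, hr]
  obtain ⟨Dh, hB⟩ := hDh
  have hV := hall Dh hB
  have hS : SchneiderConjecture Dh :=
    CensusX42.schneider_of_valRelationAt hGZ hGZK hmodD hp2 hX.typeGOrd hX.addv.2 he hr hV
  obtain ⟨Dh', hc⟩ := CensusX42.exists_pairing_eq_mul ((p : ℚ_[p])⁻¹) Dh
  have hB' := hX.leadingTermClauses_inv_prime_of_katoHalf_of_branchPAdicGrossZagier_of_shaAn_unit_of_anomalous
    hK hGZK hmod hmodD he hsurj hr hanom hB hS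
    (fun _ ↦ CensusX42.branchPAdicGrossZagierAt_of_valRelationAt hGZ hGZK W hX.addv.2 hr Dh hV)
    (fun _ ↦ CensusX42.branchPAdicGrossZagierOddAt_of_valRelationAt hGZ hGZK W hX.addv.2 hr Dh hV) hc hs hv
  have hV' := hall Dh' hB'
  have hn := CensusX42.norm_padicRegulator_eq_of_valRelationAt_of_valRelationAt hGZ hGZK hmodD hp2
    hX.typeGOrd hX.addv.2 he hr hV' hV
  rw [CensusX42.padicRegulator_eq_of_pairing_eq_mul hc, hr1, pow_one, norm_mul, norm_inv,
    Padic.norm_p, inv_inv] at hn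
  have hR : ‖padicRegulator Dh‖ ≠ 0 := norm_ne_zero_iff.mpr hS
  have hp1 : (1 : ℝ) < p := by exact_mod_cast hp.out.one_lt
  have h1 : (p : ℝ) = 1 := mul_right_cancel₀ hR (hn.trans (one_mul _).symm)
  linarith

/-- **X3♯(G-ord, `e = 2`) (reducible `E[p]`), EVERY odd `p`, `r_an = 1`, ANOMALOUS, UNIT row: the
window-grade packaging `∀ Dh, LeadingTermClauses → CensusX42.ValRelationAt W p Dh` is FALSE.**
[cite: Wuthrich2014, Thm. 16 (p. 397)] [cite: Delbourgo2002, Theorem (B) (p. 40) and p. 39 (ℓ_p(E))]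
[cite: GrossZagier1986, Thm. I.(7.3)] -/
theorem ClassX3Gord.not_forall_leadingTermClauses_imp_censusX42Val_of_shaAn_unit_of_anomalous
    (hWu : Wuthrich2014.thm16_halfEigenCharIdeal_dvd_cyclotomicPrime)
    (hGZ : GrossZagier1986_thm_I_7_3) (hGZK : rank_eq_analyticRank_of_analyticRank_le_one)
    (hmod : hasEntireLFunction_rat) (hmodD : nonempty_modularParametrizationData) (hX : ClassX3Gord W p)
    (hp2 : p ≠ 2) (he : semistabilityIndex W p = 2) (hr : W.analyticRank = 1)
    (hanom : ¬ ReductionNonAnomalous W p) (hDh : ∃ Dh : PAdicHeightData W p, LeadingTermClauses W p Dh)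
    {s : ℚ} (hs : shaAn W = (s : ℂ)) (hv : padicValRat p s = 0) :
    ¬ ∀ Dh : PAdicHeightData W p, LeadingTermClauses W p Dh → CensusX42.ValRelationAt W p Dh := by
  intro hall
  have hr1 : W.mordellWeilRank = 1 := by rw [(hGZK W hr.le).1, hr]
  obtain ⟨Dh, hB⟩ := hDh
  have hV := hall Dh hB
  have hS : SchneiderConjecture Dh :=
    CensusX42.schneider_of_valRelationAt hGZ hGZK hmodD hp2 hX.typeGOrd hX.addv he hr hV
  obtain ⟨Dh', hc⟩ := CensusX42.exists_pairing_eq_mul ((p : ℚ_[p])⁻¹) Dh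
  have hB' := hX.leadingTermClauses_inv_prime_of_wuthrichHalf_of_branchPAdicGrossZagier_of_shaAn_unit_of_anomalous
    hWu hGZK hmod hmodD hp2 he hr hanom hB hS
    (fun _ ↦ CensusX42.branchPAdicGrossZagierAt_of_valRelationAt hGZ hGZK W hX.addv hr Dh hV)
    (fun _ ↦ CensusX42.branchPAdicGrossZagierOddAt_of_valRelationAt hGZ hGZK W hX.addv hr Dh hV) hc hs hv
  have hV' := hall Dh' hB'
  have hn := CensusX42.norm_padicRegulator_eq_of_valRelationAt_of_valRelationAt hGZ hGZK hmodD hp2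
    hX.typeGOrd hX.addv he hr hV' hV
  rw [CensusX42.padicRegulator_eq_of_pairing_eq_mul hc, hr1, pow_one, norm_mul, norm_inv,
    Padic.norm_p, inv_inv] at hn
  have hR : ‖padicRegulator Dh‖ ≠ 0 := norm_ne_zero_iff.mpr hS
  have hp1 : (1 : ℝ) < p := by exact_mod_cast hp.out.one_lt
  have h1 : (p : ℝ) = 1 := mul_right_cancel₀ hR (hn.trans (one_mul _).symm)
  linarith

end Summit.BirchSwinnertonDyer.Rank1Residual.Additive

end
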